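import Literature.AnabelianGeometry.SemiGraphs.QuasiTemperoidsRmkA31Proofs
import HarnessLib

/-!
# Semi-graphs of anabelioids, Appendix: Definition A.3 (iii) bracket — quotients of QD-pairs are
# connected iff the pair is weakly connected (proofs)

Mochizuki, *Semi-graphs of anabelioids*, Publ. RIMS **42** (2006) 221–322, Appendix
"Quasi-temperoids", Definition A.3 (iii), manuscript p. 82 [cite: MochizukiSemiAnbd2006, Def A.3(iii) p.82]:
"the quotient of a QD-pair is connected if and only if the QD-pair is weakly connected".
Proof-only companion (no definitions) of `QuasiTemperoidsQDPairs.lean` (abc-iut-L3-t2): the named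
fact `QDPair.QuotientConnectedIffWeaklyConnected` is DISCHARGED
(`QDPair.quotientConnectedIffWeaklyConnected_holds`).

* `QDPair.IsQuotient.epi` — a quotient arrow is an epimorphism (formal, any category).
* Model `B^temp(Π, Π°)` (`RmkA31Model.isConnectedObj_quotient_iff`): a quotient `φ : A → B` of
  `(A, Γ_A)` is surjective on points and `Γ_A`-invariant; (⇐) the images of the components
  (orbits) of `A` are `Γ_A`-translates of one another, so `B` is a single orbit; (⇒) `A` has a point
  (else `B` would be initial), and if two orbits of `A` were not `Γ_A · Π`-related, the
  `Γ_A`-invariant map `A → B ⊔ B` ("left on the saturation of the first orbit, right off it") would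
  descend to the single orbit `B` and take both values — absurd; the relating `γ` then induces the
  isomorphism of components required by Def. A.3 (i) (orbits, injective coprojections).
* Transport along the chart `Q ≌ B^temp(Π, Π°)`: QD-pairs are pushed forward along the equivalence
  (`Γ ↦ F.mapAut Γ`), quotients are preserved (`IsQuotient.map_equivalence`), components are
  preserved and reflected (`QuasiTemperoidsRmkA31Proofs`), hence so is weak connectedness.

Nothing here bears on [IUTchIII] Cor. 3.12.
-/

open CategoryTheory CategoryTheory.Limits Topology

namespace Literature.AnabelianGeometry.SemiGraphs

open Literature.AlgebraicGeometry.Frobenioids (IsConnectedObj IsNonemptyObj)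

/-! ### Quotient arrows are epimorphisms -/

section AnyCategory

universe v₁ v₂ u₁ u₂

variable {C : Type u₁} [Category.{v₁} C] {D : Type u₂} [Category.{v₂} D]

/-- A quotient `φ : A → B ≅ A/Γ_A` of a QD-pair (Def. A.3 (iii)) is an epimorphism: two arrows out of
`B` that agree after `φ` are two factorisations of the same `Γ_A`-invariant arrow.
[cite: MochizukiSemiAnbd2006, Def A.3(iii) p.82] -/
theorem QDPair.IsQuotient.epi {P : QDPair C} {B : C} {φ : P.A ⟶ B} (h : P.IsQuotient φ) : Epi φ := by
  constructor
  intro Z a b hab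
  have hψ : ∀ γ ∈ P.Γ, γ.hom ≫ (φ ≫ a) = φ ≫ a := fun γ hγ => by
    rw [← Category.assoc, h.1 γ hγ]
  obtain ⟨ψ', -, huniq⟩ := h.2 (φ ≫ a) hψ
  exact (huniq a rfl).trans (huniq b hab.symm).symm

/-- Components (Def. A.3 (i)) are stable under pre-composition with an isomorphism.
[cite: MochizukiSemiAnbd2006, Def A.3(i) p.82] -/
theorem IsComponent.iso_comp {X' X A : C} (i : X' ≅ X) {ι : X ⟶ A} (h : IsComponent ι) :
    IsComponent (i.hom ≫ ι) := by
  obtain ⟨hX, B, κ, ⟨hc⟩⟩ := h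
  refine ⟨hX.of_iso i.symm, B, κ, ⟨BinaryCofan.IsColimit.mk _
    (fun f g => hc.desc (BinaryCofan.mk (i.inv ≫ f) g)) (fun f g => ?_) (fun f g => ?_)
    (fun f g m h₁ h₂ => ?_)⟩⟩
  · have := hc.fac (BinaryCofan.mk (i.inv ≫ f) g) ⟨WalkingPair.left⟩
    change ι ≫ _ = i.inv ≫ f at this
    change (i.hom ≫ ι) ≫ _ = f
    rw [Category.assoc, this, Iso.hom_inv_id_assoc]
  · exact hc.fac (BinaryCofan.mk (i.inv ≫ f) g) ⟨WalkingPair.right⟩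
  · apply hc.uniq (BinaryCofan.mk (i.inv ≫ f) g) m
    rintro ⟨⟨⟩⟩
    · change ι ≫ m = i.inv ≫ f
      rw [← h₁]
      change ι ≫ m = i.inv ≫ (i.hom ≫ ι) ≫ m
      rw [← Category.assoc, Iso.inv_hom_id_assoc]
    · exact h₂

/-- Components are reflected by (the functor of) an equivalence of categories.
[cite: MochizukiSemiAnbd2006, Def A.3(i) p.82] -/
theorem IsComponent.of_map_equivalence (e : C ≌ D) {X A : C} {ι : X ⟶ A}
    (h : IsComponent (e.functor.map ι)) : IsComponent ι := by
  have h1 : IsComponent (e.inverse.map (e.functor.map ι) ≫ e.unitInv.app A) :=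
    (h.map_equivalence e.symm).comp_iso (e.unitIso.app A).symm
  have h2 : e.inverse.map (e.functor.map ι) ≫ e.unitInv.app A = (e.unitIso.app X).inv ≫ ι := by
    have := e.unitInv.naturality ι
    dsimp at this
    exact this
  rw [h2] at h1
  have h3 := h1.iso_comp (e.unitIso.app X)
  have h4 : (e.unitIso.app X).hom ≫ (e.unitIso.app X).inv ≫ ι = ι :=
    (e.unitIso.app X).hom_inv_id_assoc ι
  exact (congrArg (fun t => IsComponent t) h4).mp h3

/-- Push-forward of a quotient of QD-pairs along an equivalence of categories: if `φ : A → B` is a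
quotient of `(A, Γ)`, then `F φ` is a quotient of `(F A, F Γ)`.
[cite: MochizukiSemiAnbd2006, Def A.3(iii) p.82] -/
theorem QDPair.IsQuotient.map_equivalence (e : C ≌ D) {P : QDPair C} {B : C} {φ : P.A ⟶ B}
    (h : P.IsQuotient φ) :
    (⟨e.functor.obj P.A, P.Γ.map (Functor.mapAut P.A e.functor)⟩ : QDPair D).IsQuotient
      (e.functor.map φ) := by
  constructor
  · rintro γ' ⟨γ, hγ, rfl⟩
    change (e.functor.mapIso γ).hom ≫ e.functor.map φ = e.functor.map φ
    rw [Functor.mapIso_hom, ← e.functor.map_comp, h.1 γ hγ]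
  · intro C' ψ' hψ'
    -- pull `ψ'` back to `C`
    let ψ₀ : P.A ⟶ e.inverse.obj C' := e.functor.preimage (ψ' ≫ e.counitInv.app C')
    have hψ₀ : e.functor.map ψ₀ = ψ' ≫ e.counitInv.app C' := e.functor.map_preimage _
    have hψ₀inv : ∀ γ ∈ P.Γ, γ.hom ≫ ψ₀ = ψ₀ := by
      intro γ hγ
      have hγ' : (e.functor.mapIso γ).hom ≫ ψ' = ψ' := hψ' (e.functor.mapIso γ) ⟨γ, hγ, rfl⟩
      apply e.functor.map_injective
      rw [e.functor.map_comp, hψ₀]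
      change (e.functor.mapIso γ).hom ≫ ψ' ≫ e.counitInv.app C' = ψ' ≫ e.counitInv.app C'
      conv_rhs => rw [← hγ']
      exact (Category.assoc _ _ _).symm
    obtain ⟨χ, hχ, hχu⟩ := h.2 ψ₀ hψ₀inv
    refine ⟨e.functor.map χ ≫ e.counit.app C', ?_, fun m hm => ?_⟩
    · change e.functor.map φ ≫ e.functor.map χ ≫ e.counit.app C' = ψ'
      rw [← Category.assoc, ← e.functor.map_comp, hχ, hψ₀]
      exact (Category.assoc _ _ _).trans
        ((congrArg (fun t => ψ' ≫ t) (e.counitIso.inv_hom_id_app C')).trans (Category.comp_id _))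
    · have hm' : φ ≫ e.functor.preimage (m ≫ e.counitInv.app C') = ψ₀ := by
        apply e.functor.map_injective
        rw [e.functor.map_comp, e.functor.map_preimage, hψ₀, ← Category.assoc]
        exact congrArg (· ≫ e.counitInv.app C') hm
      have := hχu _ hm'
      rw [← this, e.functor.map_preimage]
      simp

end AnyCategory

/-! ### The model `B^temp(Π, Π°)` -/

namespace RmkA31Model

open Literature.AlgebraicGeometry.Frobenioids.QuasiTemperoid (BTempRel cosetAction)
open Literature.AlgebraicGeometry.Frobenioids.QuasiTemperoid.BTempRel (hom_ρ hom_ext_apply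
  ρ_one_apply ρ_mul_apply ρ_inv_apply isNonemptyObj_of_nonempty nonempty_of_isNonemptyObj
  exists_ρ_eq_of_isConnectedObj isConnectedObj_of_transitive nonempty_of_isConnectedObj
  hom_eq_of_apply_eq exists_hom_of_stabilizer_le isInitial_of_isEmpty)

universe u

variable {G : Type u} [Group G] [TopologicalSpace G] {H : Subgroup G}

/-- **Definition A.3 (iii), bracket, in the model `B^temp(Π, Π°)`**: a quotient `φ : A → B` of a
QD-pair `(A, Γ_A)` has connected target iff the pair is weakly connected.
[cite: MochizukiSemiAnbd2006, Def A.3(iii) p.82] -/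
theorem isConnectedObj_quotient_iff {P : QDPair (BTempRel G H)} {B : BTempRel G H}
    (φ : P.A ⟶ B) (hφ : P.IsQuotient φ) : IsConnectedObj B ↔ P.IsWeaklyConnected := by
  classical
  haveI := hφ.epi
  have hsurj := surjective_of_epi φ
  have hinv : ∀ γ ∈ P.Γ, ∀ a : P.A.obj.obj.V,
      (φ.hom.hom.hom (γ.hom.hom.hom.hom a) : B.obj.obj.V) = φ.hom.hom.hom a :=
    fun γ hγ a => congrArg (fun ψ : P.A ⟶ B => (ψ.hom.hom.hom a : B.obj.obj.V)) (hφ.1 γ hγ)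
  constructor
  · intro hB
    refine ⟨?_, fun C₁ C₂ ι₁ ι₂ hι₁ hι₂ => ?_⟩
    · -- `A` has a point: otherwise `B` would be initial
      by_contra hA
      have hAe : IsEmpty P.A.obj.obj.V := ⟨fun a => hA (isNonemptyObj_of_nonempty P.A a)⟩
      obtain ⟨hI⟩ := isInitial_of_isEmpty P.A hAe
      refine hB.1.false (IsInitial.ofUniqueHom
        (fun C => (hφ.2 (hI.to C) (fun γ _ => hI.hom_ext _ _)).choose) fun C m => ?_)
      exact (hφ.2 (hI.to C) (fun γ _ => hI.hom_ext _ _)).choose_spec.2 m (hI.hom_ext _ _)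
    · obtain ⟨c₁⟩ := nonempty_of_isConnectedObj C₁ hι₁.1
      obtain ⟨c₂⟩ := nonempty_of_isConnectedObj C₂ hι₂.1
      obtain ⟨D₁, κ₁, ⟨hc₁⟩⟩ := hι₁.2
      obtain ⟨D₂, κ₂, ⟨hc₂⟩⟩ := hι₂.2
      have hinj₁ := injective_of_isColimit_binaryCofan ι₁ κ₁ hc₁
      have hinj₂ := injective_of_isColimit_binaryCofan ι₂ κ₂ hc₂
      -- the two orbits are `Γ_A · Π`-related
      have key : ∃ γ ∈ P.Γ, ∃ g : G,
          (γ.hom.hom.hom.hom (P.A.obj.obj.ρ g (ι₁.hom.hom.hom c₁)) : P.A.obj.obj.V) =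
            ι₂.hom.hom.hom c₂ := by
        by_contra hnot
        push Not at hnot
        obtain ⟨W, e, j₁, j₂, hj₁, hj₂, -, -, -⟩ := exists_sum B B
        -- the saturation `U` of the first orbit and the test map `A → B ⊔ B`
        let U : Set P.A.obj.obj.V := fun a => ∃ γ ∈ P.Γ, ∃ g : G,
          (γ.hom.hom.hom.hom (P.A.obj.obj.ρ g (ι₁.hom.hom.hom c₁)) : P.A.obj.obj.V) = a
        have hUρ : ∀ (g : G) (a : P.A.obj.obj.V), P.A.obj.obj.ρ g a ∈ U ↔ a ∈ U := by
          intro g a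
          constructor
          · rintro ⟨γ, hγ, g', h⟩
            refine ⟨γ, hγ, g⁻¹ * g', ?_⟩
            rw [ρ_mul_apply, hom_ρ, h, ρ_inv_apply]
          · rintro ⟨γ, hγ, g', h⟩
            refine ⟨γ, hγ, g * g', ?_⟩
            rw [ρ_mul_apply, hom_ρ, h]
        have hUΓ : ∀ δ ∈ P.Γ, ∀ a : P.A.obj.obj.V, (δ.hom.hom.hom.hom a : P.A.obj.obj.V) ∈ U ↔ a ∈ U := by
          intro δ hδ a
          constructor
          · rintro ⟨γ, hγ, g', h⟩
            refine ⟨δ⁻¹ * γ, P.Γ.mul_mem (P.Γ.inv_mem hδ) hγ, g', ?_⟩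
            have h' := congrArg (fun x => (δ.inv.hom.hom.hom x : P.A.obj.obj.V)) h
            change ((γ.hom ≫ δ.inv).hom.hom.hom _ : P.A.obj.obj.V) = (δ.hom ≫ δ.inv).hom.hom.hom a at h'
            rw [δ.hom_inv_id] at h'
            exact h'
          · rintro ⟨γ, hγ, g', h⟩
            refine ⟨δ * γ, P.Γ.mul_mem hδ hγ, g', ?_⟩
            change ((γ.hom ≫ δ.hom).hom.hom.hom _ : P.A.obj.obj.V) = _
            exact congrArg (fun x => (δ.hom.hom.hom.hom x : P.A.obj.obj.V)) h
        let ψfun : P.A.obj.obj.V → W.obj.obj.V := fun a =>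
          if a ∈ U then j₁.hom.hom.hom (φ.hom.hom.hom a) else j₂.hom.hom.hom (φ.hom.hom.hom a)
        have ψ_pos : ∀ a, a ∈ U → ψfun a = j₁.hom.hom.hom (φ.hom.hom.hom a) := fun a h => if_pos h
        have ψ_neg : ∀ a, a ∉ U → ψfun a = j₂.hom.hom.hom (φ.hom.hom.hom a) := fun a h => if_neg h
        let ψ : P.A ⟶ W := ObjectProperty.homMk (ObjectProperty.homMk
          { hom := TypeCat.ofHom ψfun
            comm := fun g => by
              apply ConcreteCategory.hom_ext
              intro a
              change ψfun (P.A.obj.obj.ρ g a) = W.obj.obj.ρ g (ψfun a)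
              by_cases ha : a ∈ U
              · rw [ψ_pos a ha, ψ_pos _ ((hUρ g a).mpr ha), hom_ρ, hom_ρ]
              · rw [ψ_neg a ha, ψ_neg _ (fun h => ha ((hUρ g a).mp h)), hom_ρ, hom_ρ] })
        have hψinv : ∀ δ ∈ P.Γ, δ.hom ≫ ψ = ψ := by
          intro δ hδ
          apply hom_ext_apply
          intro a
          change ψfun (δ.hom.hom.hom.hom a) = ψfun a
          by_cases ha : a ∈ U
          · rw [ψ_pos a ha, ψ_pos _ ((hUΓ δ hδ a).mpr ha), hinv δ hδ]
          · rw [ψ_neg a ha, ψ_neg _ (fun h => ha ((hUΓ δ hδ a).mp h)), hinv δ hδ]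
        obtain ⟨ψ', hψ', -⟩ := hφ.2 ψ hψinv
        have hψ'a : ∀ a, (ψ'.hom.hom.hom (φ.hom.hom.hom a) : W.obj.obj.V) = ψfun a := fun a =>
          congrArg (fun χ : P.A ⟶ W => (χ.hom.hom.hom a : W.obj.obj.V)) hψ'
        -- `B` is one orbit: `φ a₂ = g₀ · φ a₁`
        obtain ⟨g₀, hg₀⟩ := exists_ρ_eq_of_isConnectedObj B hB
          (φ.hom.hom.hom (ι₁.hom.hom.hom c₁)) (φ.hom.hom.hom (ι₂.hom.hom.hom c₂))
        have hU₁ : ι₁.hom.hom.hom c₁ ∈ U := ⟨1, P.Γ.one_mem, 1, by rw [ρ_one_apply]; rfl⟩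
        have hU₂ : ι₂.hom.hom.hom c₂ ∉ U := fun ⟨γ, hγ, g, h⟩ => hnot γ hγ g h
        have e₁ : e (ψ'.hom.hom.hom (φ.hom.hom.hom (ι₂.hom.hom.hom c₂))) =
            Sum.inr (φ.hom.hom.hom (ι₂.hom.hom.hom c₂)) := by
          rw [hψ'a, ψ_neg _ hU₂, hj₂]
        have e₂ : e (ψ'.hom.hom.hom (φ.hom.hom.hom (ι₂.hom.hom.hom c₂))) =
            Sum.inl (B.obj.obj.ρ g₀ (φ.hom.hom.hom (ι₁.hom.hom.hom c₁))) := by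
          rw [← hg₀, hom_ρ ψ', hψ'a, ψ_pos _ hU₁, ← hom_ρ j₁, hj₁]
        rw [e₁] at e₂
        exact Sum.inr_ne_inl e₂
      obtain ⟨γ, hγ, g, hg⟩ := key
      -- the point of `C₂` over `γ a₁`
      let t₂ : C₂.obj.obj.V := C₂.obj.obj.ρ g⁻¹ c₂
      have ht₂ : (ι₂.hom.hom.hom t₂ : P.A.obj.obj.V) = γ.hom.hom.hom.hom (ι₁.hom.hom.hom c₁) := by
        change (ι₂.hom.hom.hom (C₂.obj.obj.ρ g⁻¹ c₂) : P.A.obj.obj.V) = _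
        rw [hom_ρ, ← hg, ← hom_ρ γ.hom, ρ_inv_apply]
      have hγinv : ∀ x : P.A.obj.obj.V, (γ.inv.hom.hom.hom (γ.hom.hom.hom.hom x) : P.A.obj.obj.V) = x :=
        fun x => congrArg (fun χ : P.A ⟶ P.A => (χ.hom.hom.hom x : P.A.obj.obj.V)) γ.hom_inv_id
      -- the isomorphism `C₁ ≅ C₂`
      obtain ⟨eh, heh⟩ := exists_hom_of_stabilizer_le (T₁ := C₁) (T₂ := C₂) c₁
        (exists_ρ_eq_of_isComponent hι₁ c₁) t₂ (fun s hs => by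
          apply hinj₂
          change (ι₂.hom.hom.hom (C₂.obj.obj.ρ s t₂) : P.A.obj.obj.V) = ι₂.hom.hom.hom t₂
          rw [hom_ρ, ht₂, ← hom_ρ γ.hom, ← hom_ρ ι₁, hs])
      have htr₂ : ∀ c : C₂.obj.obj.V, ∃ s : G, C₂.obj.obj.ρ s t₂ = c := by
        intro c
        obtain ⟨s, hs⟩ := exists_ρ_eq_of_isComponent hι₂ c₂ c
        refine ⟨s * g, ?_⟩
        change C₂.obj.obj.ρ (s * g) (C₂.obj.obj.ρ g⁻¹ c₂) = c
        rw [← ρ_mul_apply, mul_assoc, mul_inv_cancel, mul_one, hs]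
      obtain ⟨ei, hei⟩ := exists_hom_of_stabilizer_le (T₁ := C₂) (T₂ := C₁) t₂ htr₂
        c₁ (fun s hs => by
          apply hinj₁
          change (ι₁.hom.hom.hom (C₁.obj.obj.ρ s c₁) : P.A.obj.obj.V) = ι₁.hom.hom.hom c₁
          rw [hom_ρ, ← hγinv (ι₁.hom.hom.hom c₁), ← hom_ρ γ.inv, ← ht₂, ← hom_ρ ι₂, hs])
      have hehi : eh ≫ ei = 𝟙 C₁ := hom_eq_of_apply_eq hι₁.1 _ _ c₁ (by
        change (ei.hom.hom.hom (eh.hom.hom.hom c₁) : C₁.obj.obj.V) = c₁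
        rw [heh, hei])
      have hieh : ei ≫ eh = 𝟙 C₂ := hom_eq_of_apply_eq hι₂.1 _ _ t₂ (by
        change (eh.hom.hom.hom (ei.hom.hom.hom t₂) : C₂.obj.obj.V) = t₂
        rw [hei, heh])
      refine ⟨γ, hγ, ⟨eh, ei, hehi, hieh⟩, hom_eq_of_apply_eq hι₁.1 _ _ c₁ ?_⟩
      change (γ.hom.hom.hom.hom (ι₁.hom.hom.hom c₁) : P.A.obj.obj.V) = ι₂.hom.hom.hom (eh.hom.hom.hom c₁)
      rw [heh, ht₂]
  · rintro ⟨hAne, hcomp⟩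
    obtain ⟨a₀⟩ := nonempty_of_isNonemptyObj P.A hAne
    refine isConnectedObj_of_transitive B (φ.hom.hom.hom a₀) fun b => ?_
    obtain ⟨a, ha⟩ := hsurj b
    change (φ.hom.hom.hom a : B.obj.obj.V) = b at ha
    obtain ⟨C₁, ι₁, c₁, hι₁, hc₁, -⟩ := exists_isComponent_orbit P.A a₀
    obtain ⟨C₂, ι₂, c₂, hι₂, hc₂, -⟩ := exists_isComponent_orbit P.A a
    obtain ⟨γ, hγ, e, he⟩ := hcomp ι₁ ι₂ hι₁ hι₂
    obtain ⟨g, hg⟩ := exists_ρ_eq_of_isComponent hι₂ c₂ (e.hom.hom.hom.hom c₁)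
    have h1 : (γ.hom.hom.hom.hom a₀ : P.A.obj.obj.V) = P.A.obj.obj.ρ g a := by
      rw [← hc₁, ← hc₂, ← hom_ρ ι₂, hg]
      exact congrArg (fun χ : C₁ ⟶ P.A => (χ.hom.hom.hom c₁ : P.A.obj.obj.V)) he
    refine ⟨g⁻¹, ?_⟩
    rw [← hinv γ hγ a₀, h1, hom_ρ, ρ_inv_apply, ha]

end RmkA31Model

/-! ### Weak connectedness along an equivalence; the named fact -/

section Transport

universe v₁ v₂ u₁ u₂

variable {C : Type u₁} [Category.{v₁} C] {D : Type u₂} [Category.{v₂} D]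

/-- Weak connectedness of a QD-pair (Def. A.3 (i)) is invariant under pushing the pair forward along
an equivalence of categories (`Γ ↦ F Γ`): components correspond (`IsComponent.map_equivalence` /
`of_map_equivalence` / `iso_comp`), and so do the relating automorphisms and isomorphisms (`F` is
fully faithful). [cite: MochizukiSemiAnbd2006, Def A.3(i) p.82] -/
theorem QDPair.isWeaklyConnected_iff_map_equivalence (e : C ≌ D) (P : QDPair C) :
    P.IsWeaklyConnected ↔
      (⟨e.functor.obj P.A, P.Γ.map (Functor.mapAut P.A e.functor)⟩ : QDPair D).IsWeaklyConnected := by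
  constructor
  · rintro ⟨hne, hcomp⟩
    refine ⟨TemperoidTransport.isNonemptyObj_functor_obj e hne, fun C₁' C₂' ι₁' ι₂' hι₁' hι₂' => ?_⟩
    -- pull the components back to `C`
    let κ₁ : e.inverse.obj C₁' ⟶ P.A := e.functor.preimage (e.counit.app C₁' ≫ ι₁')
    let κ₂ : e.inverse.obj C₂' ⟶ P.A := e.functor.preimage (e.counit.app C₂' ≫ ι₂')
    have hκ₁F : e.functor.map κ₁ = e.counit.app C₁' ≫ ι₁' := e.functor.map_preimage _
    have hκ₂F : e.functor.map κ₂ = e.counit.app C₂' ≫ ι₂' := e.functor.map_preimage _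
    have hκ₁ : IsComponent κ₁ :=
      IsComponent.of_map_equivalence e (hκ₁F ▸ hι₁'.iso_comp (e.counitIso.app C₁'))
    have hκ₂ : IsComponent κ₂ :=
      IsComponent.of_map_equivalence e (hκ₂F ▸ hι₂'.iso_comp (e.counitIso.app C₂'))
    obtain ⟨γ, hγ, ee, heq⟩ := hcomp κ₁ κ₂ hκ₁ hκ₂
    have hF : e.functor.map κ₁ ≫ e.functor.map γ.hom =
        e.functor.map ee.hom ≫ e.functor.map κ₂ := by
      rw [← Functor.map_comp, heq, Functor.map_comp]
    rw [hκ₁F, hκ₂F] at hF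
    refine ⟨e.functor.mapIso γ, ⟨γ, hγ, rfl⟩,
      (e.counitIso.app C₁').symm ≪≫ e.functor.mapIso ee ≪≫ e.counitIso.app C₂', ?_⟩
    change ι₁' ≫ e.functor.map γ.hom =
      (e.counitInv.app C₁' ≫ e.functor.map ee.hom ≫ e.counit.app C₂') ≫ ι₂'
    apply (cancel_epi (e.counit.app C₁')).mp
    erw [← Category.assoc, hF]
    simp only [Category.assoc]
    exact (e.counitIso.hom_inv_id_app_assoc C₁' _).symm
  · rintro ⟨hne', hcomp'⟩
    refine ⟨TemperoidTransport.isNonemptyObj_of_functor e hne', fun C₁ C₂ ι₁ ι₂ hι₁ hι₂ => ?_⟩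
    obtain ⟨γ', ⟨γ, hγ, rfl⟩, e', heq'⟩ :=
      hcomp' (e.functor.map ι₁) (e.functor.map ι₂) (hι₁.map_equivalence e) (hι₂.map_equivalence e)
    refine ⟨γ, hγ, e.functor.preimageIso e', e.functor.map_injective ?_⟩
    rw [Functor.map_comp, Functor.map_comp]
    change e.functor.map ι₁ ≫ (e.functor.mapIso γ).hom =
      e.functor.map (e.functor.preimage e'.hom) ≫ e.functor.map ι₂
    rw [e.functor.map_preimage]
    exact heq'

end Transport

open Literature.AlgebraicGeometry.Frobenioids.QuasiTemperoid (IsConnectedQuasiTemperoid BTempRel)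

universe v₁ u u₁

/-- **Definition A.3 (iii), bracket, DISCHARGED** (SemiAnbd Appendix p. 82): in a connected
quasi-temperoid, "the quotient of a QD-pair is connected if and only if the QD-pair is weakly
connected".  Proof: push the QD-pair and its quotient forward along a chart `Q ≌ B^temp(Π, Π°)`
(`QDPair.IsQuotient.map_equivalence`), decide there (`RmkA31Model.isConnectedObj_quotient_iff`), and
transport both sides back (`TemperoidTransport.isConnectedObj_functor_obj` / `_of_functor`,
`QDPair.isWeaklyConnected_iff_map_equivalence`). [cite: MochizukiSemiAnbd2006, Def A.3(iii) p.82] -/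
theorem QDPair.quotientConnectedIffWeaklyConnected_holds :
    QDPair.QuotientConnectedIffWeaklyConnected.{v₁, u, u₁} := by
  intro Q _ hQ P B φ hφ
  obtain ⟨G, _, _, _, H, -, -, ⟨e⟩⟩ := hQ.exists_equiv
  have hmodel := RmkA31Model.isConnectedObj_quotient_iff
    (P := ⟨e.functor.obj P.A, P.Γ.map (Functor.mapAut P.A e.functor)⟩) (e.functor.map φ)
    (hφ.map_equivalence e)
  constructor
  · intro hB
    exact (QDPair.isWeaklyConnected_iff_map_equivalence e P).mpr
      (hmodel.mp (TemperoidTransport.isConnectedObj_functor_obj e hB))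
  · intro hW
    exact TemperoidTransport.isConnectedObj_of_functor e
      (hmodel.mpr ((QDPair.isWeaklyConnected_iff_map_equivalence e P).mp hW))

end Literature.AnabelianGeometry.SemiGraphs
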